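import Summits.Ventures.PercRepro.MSTightNoExtraGround
import Summits.Ventures.PercRepro.MSTightProjectionSlack
import Summits.Ventures.PercRepro.MSTightUniqueNonFace

/-!
# The restriction of an instance to `u` ((F5) iterated; the count (R) of the proof of (R*-M))

Dossier proofs/MINE1-theoremS.md, Addendum 37 (F5), Addendum 38 §1, and
proofs/MINE1-RSTARM-PROOF.md §1 (R). Projecting a family `F` along a SET `B` (`projSet B F`, every
member with `B` removed) is the iteration of the single projections `proj m`; iterating the count
of MSTightProjectionSlack.lean (`card_filter_le_card_proj_add_one`) along the elements of `B`
gives **the slack of the projected data along `B` is at most the slack**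
(`card_filter_disjoint_le_card_projSet_add_one`): for a down-set `Y ⊇ F \\ F` with
`|Y| ≤ |F| + 1`, the members of `Y` avoiding `B` number at most `|projSet B F| + 1`.

With `B = S \ u` this is the restriction to `u`: the traces `y ∩ u` of the members of `T` and the
faces inside `u`. The restriction of an instance `(S, L', u, T)` is an instance on the ground set
`u` (`hdown`, `hTU`, (Sig), (AO) transfer directly, the count by the lemma above), so the ground-set
(F2) of MSTightNoExtraGround.lean applies to it and gives **the count (R)**: with `C` the complex
of `T` (`hC`, `hCT`), `|A_u ∩ C_u| = |A_u^⊥ ∩ C_u| + 1` where `A_u = L' ∩ 2^u`, `C_u = C ∩ 2^u` and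
`A_u^⊥ = complWithin u A_u` — exactly the hypothesis `hcount` of the unique-non-face lemma
(MSTightUniqueNonFace.lean) and of the anatomy (MSTightAnatomy.lean)
(`card_inter_eq_card_complWithin_inter_add_one`); on the way, the traces are exactly the sets
`x ⊆ u` with `u \ x ∈ L'` below a member (`image_inter_eq_filter`).
-/

namespace PercRepro.MSTight

open Finset
open scoped FinsetFamily

variable {α : Type*} [DecidableEq α]

/-- The projection of a family along a set `B`: every member with `B` removed. -/
def projSet (B : Finset α) (F : Finset (Finset α)) : Finset (Finset α) := F.image fun y => y \ B

/-- Membership in `projSet`. -/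
theorem mem_projSet {B : Finset α} {F : Finset (Finset α)} {x : Finset α} :
    x ∈ projSet B F ↔ ∃ y ∈ F, y \ B = x := by
  simp [projSet]

/-- Projecting along `∅` does nothing. -/
theorem projSet_empty (F : Finset (Finset α)) : projSet ∅ F = F := by
  simp [projSet]

/-- Projecting along `insert m B` is projecting along `B`, then along `m`. -/
theorem projSet_insert (m : α) (B : Finset α) (F : Finset (Finset α)) :
    projSet (insert m B) F = proj m (projSet B F) := by
  ext x
  simp only [mem_projSet, mem_proj]
  constructor
  · rintro ⟨y, hy, rfl⟩
    exact ⟨y \ B, ⟨y, hy, rfl⟩, by rw [sdiff_insert]⟩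
  · rintro ⟨z, ⟨y, hy, rfl⟩, rfl⟩
    exact ⟨y, hy, by rw [sdiff_insert]⟩

/-- A difference of the projected family is a projected difference. -/
theorem diffs_projSet_subset {B : Finset α} {F : Finset (Finset α)} :
    projSet B F \\ projSet B F ⊆ (F \\ F).image fun d => d \ B := by
  intro d hd
  obtain ⟨x, hx, x', hx', rfl⟩ := mem_diffs.1 hd
  obtain ⟨y, hy, rfl⟩ := mem_projSet.1 hx
  obtain ⟨y', hy', rfl⟩ := mem_projSet.1 hx'
  refine mem_image.2 ⟨y \ y', mem_diffs.2 ⟨y, hy, y', hy', rfl⟩, ?_⟩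
  ext a
  simp only [mem_sdiff]
  tauto

/-- **The slack of the projected data along a set `B` is at most the slack.** For a down-set
`Y ⊇ F \\ F` with `|Y| ≤ |F| + 1`, the members of `Y` avoiding `B` number at most
`|projSet B F| + 1`. -/
theorem card_filter_disjoint_le_card_projSet_add_one {F Y : Finset (Finset α)}
    (hYdown : IsDownSet Y) (hY : F \\ F ⊆ Y) (hcnt : Y.card ≤ F.card + 1) (B : Finset α) :
    (Y.filter fun w => Disjoint w B).card ≤ (projSet B F).card + 1 := by
  induction B using Finset.induction_on with
  | empty =>
    rw [projSet_empty]
    refine le_trans (card_le_card (filter_subset _ _)) hcnt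
  | insert m B _ ih =>
    rw [projSet_insert]
    have h1 : (Y.filter fun w => Disjoint w (insert m B)) =
        (Y.filter fun w => Disjoint w B).filter fun w => m ∉ w := by
      ext w
      simp only [mem_filter, disjoint_insert_right]
      tauto
    rw [h1]
    refine card_filter_le_card_proj_add_one ?_ ih
    intro d hd
    obtain ⟨d', hd', rfl⟩ := mem_image.1 (diffs_projSet_subset hd)
    exact mem_filter.2 ⟨hYdown _ (hY hd') _ sdiff_subset, disjoint_sdiff_self_left⟩

/-- For `y ⊆ S`, removing `S \ u` is intersecting with `u`. -/
theorem sdiff_sdiff_eq_inter_of_subset {S u y : Finset α} (hy : y ⊆ S) : y \ (S \ u) = y ∩ u := by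
  ext a
  simp only [mem_sdiff, mem_inter, not_and, not_not]
  constructor
  · rintro ⟨ha, h⟩; exact ⟨ha, h (hy ha)⟩
  · rintro ⟨ha, hau⟩; exact ⟨ha, fun _ => hau⟩

/-- The projection along `S \ u` of a family of subsets of `S` is the family of traces `y ∩ u`. -/
theorem projSet_sdiff_eq_image_inter {S u : Finset α} {F : Finset (Finset α)}
    (hFS : ∀ y ∈ F, y ⊆ S) : projSet (S \ u) F = F.image fun y => y ∩ u := by
  ext x
  simp only [mem_projSet, mem_image]
  constructor
  · rintro ⟨y, hy, rfl⟩; exact ⟨y, hy, (sdiff_sdiff_eq_inter_of_subset (hFS y hy)).symm⟩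
  · rintro ⟨y, hy, rfl⟩; exact ⟨y, hy, sdiff_sdiff_eq_inter_of_subset (hFS y hy)⟩

/-- **The restriction count.** For a down-set `Y ⊇ F \\ F` of subsets of `S` with `|Y| ≤ |F| + 1`
and a family `F` of subsets of `S`, the members of `Y` inside `u` number at most one more than the
traces `y ∩ u`. -/
theorem card_filter_subset_le_card_image_inter_add_one {S u : Finset α} {F Y : Finset (Finset α)}
    (hYdown : IsDownSet Y) (hY : F \\ F ⊆ Y) (hcnt : Y.card ≤ F.card + 1)
    (hFS : ∀ y ∈ F, y ⊆ S) (hYS : ∀ w ∈ Y, w ⊆ S) :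
    (Y.filter fun w => w ⊆ u).card ≤ (F.image fun y => y ∩ u).card + 1 := by
  have h := card_filter_disjoint_le_card_projSet_add_one hYdown hY hcnt (S \ u)
  rw [projSet_sdiff_eq_image_inter hFS] at h
  have h1 : (Y.filter fun w => w ⊆ u) = Y.filter fun w => Disjoint w (S \ u) := by
    ext w
    simp only [mem_filter]
    constructor
    · rintro ⟨hw, hwu⟩
      exact ⟨hw, disjoint_of_subset_left hwu disjoint_sdiff⟩
    · rintro ⟨hw, hdis⟩
      refine ⟨hw, fun a ha => ?_⟩
      by_contra hau
      exact disjoint_left.1 hdis ha (mem_sdiff.2 ⟨hYS w hw ha, hau⟩)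
  rw [h1]; exact h

/-- The faces of the restricted data are the faces inside `u`. -/
theorem faces_restrict_eq {L' T : Finset (Finset α)} (u : Finset α) :
    ((L'.filter fun w => w ⊆ u).filter fun w => ∃ y ∈ T.image (fun y => y ∩ u), w ⊆ y) =
      (L'.filter fun w => ∃ y ∈ T, w ⊆ y).filter fun w => w ⊆ u := by
  ext w
  simp only [mem_filter, mem_image]
  constructor
  · rintro ⟨⟨hw, hwu⟩, y, ⟨t, ht, rfl⟩, hwy⟩
    exact ⟨⟨hw, t, ht, hwy.trans inter_subset_left⟩, hwu⟩
  · rintro ⟨⟨hw, t, ht, hwt⟩, hwu⟩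
    exact ⟨⟨hw, hwu⟩, t ∩ u, ⟨t, ht, rfl⟩, subset_inter hwt hwu⟩

section Instance

variable {S u : Finset α} {L' T : Finset (Finset α)}

/-- The restriction of an instance to `u`: the down-set `L' ∩ 2^u` is a down-set. -/
theorem hdown_restrict (hdown : ∀ w ∈ L', ∀ w', w' ⊆ w → w' ∈ L') :
    ∀ w ∈ L'.filter (fun w => w ⊆ u), ∀ w', w' ⊆ w → w' ∈ L'.filter (fun w => w ⊆ u) := by
  intro w hw w' hw'
  rw [mem_filter] at hw ⊢
  exact ⟨hdown w hw.1 w' hw', hw'.trans hw.2⟩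

/-- The restriction of an instance to `u`: the traces have their `u`-complements in `L' ∩ 2^u`. -/
theorem hTU_restrict (hdown : ∀ w ∈ L', ∀ w', w' ⊆ w → w' ∈ L') (huS : u ⊆ S)
    (hTU : ∀ y ∈ T, S \ y ∈ L') :
    ∀ y ∈ T.image (fun y => y ∩ u), u \ y ∈ L'.filter (fun w => w ⊆ u) := by
  intro y hy
  obtain ⟨t, ht, rfl⟩ := mem_image.1 hy
  rw [mem_filter]
  refine ⟨hdown _ (hTU t ht) _ ?_, sdiff_subset⟩
  intro a ha
  rw [mem_sdiff, mem_inter] at ha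
  exact mem_sdiff.2 ⟨huS ha.1, fun h => ha.2 ⟨h, ha.1⟩⟩

/-- The restriction of an instance to `u`: (Sig) transfers. -/
theorem hsig_restrict
    (hsig : ∀ v ∈ L', v ⊆ u → u \ v ∈ L' ∨ ∃ y ∈ T, v ⊆ y) :
    ∀ v ∈ L'.filter (fun w => w ⊆ u), v ⊆ u →
      u \ v ∈ L'.filter (fun w => w ⊆ u) ∨ ∃ y ∈ T.image (fun y => y ∩ u), v ⊆ y := by
  intro v hv hvu
  rw [mem_filter] at hv
  rcases hsig v hv.1 hvu with h | ⟨y, hy, hvy⟩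
  · exact Or.inl (mem_filter.2 ⟨h, sdiff_subset⟩)
  · exact Or.inr ⟨y ∩ u, mem_image.2 ⟨y, hy, rfl⟩, subset_inter hvy hvu⟩

/-- The restriction of an instance to `u`: (AO) transfers. -/
theorem hao_restrict
    (hao : ∃ v₀ ∈ L', v₀ ⊆ u ∧ u \ v₀ ∈ L' ∧ ∀ y ∈ T, ¬ v₀ ⊆ y) :
    ∃ v₀ ∈ L'.filter (fun w => w ⊆ u), v₀ ⊆ u ∧ u \ v₀ ∈ L'.filter (fun w => w ⊆ u) ∧
      ∀ y ∈ T.image (fun y => y ∩ u), ¬ v₀ ⊆ y := by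
  obtain ⟨v₀, hv₀, hv₀u, hv₀c, hv₀T⟩ := hao
  refine ⟨v₀, mem_filter.2 ⟨hv₀, hv₀u⟩, hv₀u, mem_filter.2 ⟨hv₀c, sdiff_subset⟩, ?_⟩
  intro y hy hsub
  obtain ⟨t, ht, rfl⟩ := mem_image.1 hy
  exact hv₀T t ht (hsub.trans inter_subset_left)

/-- The restriction of an instance to `u`: the count (Cnt) transfers. -/
theorem hcnt_restrict (hdown : ∀ w ∈ L', ∀ w', w' ⊆ w → w' ∈ L')
    (hTS : ∀ y ∈ T, y ⊆ S) (hTU : ∀ y ∈ T, S \ y ∈ L')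
    (hcnt : ((L'.filter fun w => ∃ y ∈ T, w ⊆ y)).card ≤ T.card + 1) :
    ((L'.filter fun w => w ⊆ u).filter fun w => ∃ y ∈ T.image (fun y => y ∩ u), w ⊆ y).card ≤
      (T.image fun y => y ∩ u).card + 1 := by
  rw [faces_restrict_eq]
  refine card_filter_subset_le_card_image_inter_add_one (S := S)
    (isDownSet_filter_exists_subset hdown) (diffs_subset_faces_ground hdown hTS hTU) hcnt hTS ?_
  intro w hw
  obtain ⟨-, y, hy, hwy⟩ := mem_filter.1 hw
  exact hwy.trans (hTS y hy)

/-- **The restriction of an instance is an instance on the ground set `u`; its slack is one.** -/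
theorem card_faces_restrict_eq_succ (hdown : ∀ w ∈ L', ∀ w', w' ⊆ w → w' ∈ L')
    (hne : T.Nonempty) (hTS : ∀ y ∈ T, y ⊆ S) (hTU : ∀ y ∈ T, S \ y ∈ L')
    (hcnt : ((L'.filter fun w => ∃ y ∈ T, w ⊆ y)).card ≤ T.card + 1)
    (huS : u ⊆ S) (hu : u ∉ L')
    (hsig : ∀ v ∈ L', v ⊆ u → u \ v ∈ L' ∨ ∃ y ∈ T, v ⊆ y)
    (hao : ∃ v₀ ∈ L', v₀ ⊆ u ∧ u \ v₀ ∈ L' ∧ ∀ y ∈ T, ¬ v₀ ⊆ y) :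
    ((L'.filter fun w => ∃ y ∈ T, w ⊆ y).filter fun w => w ⊆ u).card =
      (T.image fun y => y ∩ u).card + 1 := by
  rw [← faces_restrict_eq]
  refine card_faces_eq_succ_ground (S := u) (hdown_restrict hdown) (hne.image _)
    (fun y hy => by obtain ⟨t, -, rfl⟩ := mem_image.1 hy; exact inter_subset_right)
    (hTU_restrict hdown huS hTU) (hcnt_restrict hdown hTS hTU hcnt) u (subset_refl u)
    (fun h => hu (mem_filter.1 h).1) (hsig_restrict hsig) (hao_restrict hao)

/-- **The traces are the members of `U` inside `u` below a member** (`T|_u = U_u ∩ C_u`): a set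
`x ⊆ u` with `u \ x ∈ L'` lying below a member of `T` is a trace. -/
theorem mem_image_inter_of_sdiff_mem (hdown : ∀ w ∈ L', ∀ w', w' ⊆ w → w' ∈ L')
    (hTS : ∀ y ∈ T, y ⊆ S) (hTU : ∀ y ∈ T, S \ y ∈ L')
    (hcnt : ((L'.filter fun w => ∃ y ∈ T, w ⊆ y)).card ≤ T.card + 1)
    (huS : u ⊆ S) (hu : u ∉ L')
    (hsig : ∀ v ∈ L', v ⊆ u → u \ v ∈ L' ∨ ∃ y ∈ T, v ⊆ y)
    (hao : ∃ v₀ ∈ L', v₀ ⊆ u ∧ u \ v₀ ∈ L' ∧ ∀ y ∈ T, ¬ v₀ ⊆ y)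
    {x : Finset α} (hxu : x ⊆ u) (hx : u \ x ∈ L') (hxT : ∃ t ∈ T, x ⊆ t) :
    x ∈ T.image fun y => y ∩ u := by
  refine mem_of_compl_mem_of_exists_subset_ground (S := u) (hdown_restrict hdown)
    (fun y hy => by obtain ⟨t, -, rfl⟩ := mem_image.1 hy; exact inter_subset_right)
    (hTU_restrict hdown huS hTU) (hcnt_restrict hdown hTS hTU hcnt) u (subset_refl u)
    (fun h => hu (mem_filter.1 h).1) (hsig_restrict hsig) (hao_restrict hao) hxu
    (mem_filter.2 ⟨hx, sdiff_subset⟩) ?_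
  obtain ⟨t, ht, hxt⟩ := hxT
  exact ⟨t ∩ u, mem_image.2 ⟨t, ht, rfl⟩, subset_inter hxt hxu⟩

/-- The traces are exactly the sets `x ⊆ u` with `u \ x ∈ L'` below a member. -/
theorem image_inter_eq_filter (hdown : ∀ w ∈ L', ∀ w', w' ⊆ w → w' ∈ L')
    (hTS : ∀ y ∈ T, y ⊆ S) (hTU : ∀ y ∈ T, S \ y ∈ L')
    (hcnt : ((L'.filter fun w => ∃ y ∈ T, w ⊆ y)).card ≤ T.card + 1)
    (huS : u ⊆ S) (hu : u ∉ L')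
    (hsig : ∀ v ∈ L', v ⊆ u → u \ v ∈ L' ∨ ∃ y ∈ T, v ⊆ y)
    (hao : ∃ v₀ ∈ L', v₀ ⊆ u ∧ u \ v₀ ∈ L' ∧ ∀ y ∈ T, ¬ v₀ ⊆ y) :
    (T.image fun y => y ∩ u) =
      u.powerset.filter fun x => u \ x ∈ L' ∧ ∃ t ∈ T, x ⊆ t := by
  ext x
  simp only [mem_filter, mem_powerset]
  constructor
  · intro hx
    obtain ⟨t, ht, rfl⟩ := mem_image.1 hx
    refine ⟨inter_subset_right, hdown _ (hTU t ht) _ ?_, t, ht, inter_subset_left⟩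
    intro a ha
    rw [mem_sdiff, mem_inter] at ha
    exact mem_sdiff.2 ⟨huS ha.1, fun h => ha.2 ⟨h, ha.1⟩⟩
  · rintro ⟨hxu, hx, hxT⟩
    exact mem_image_inter_of_sdiff_mem hdown hTS hTU hcnt huS hu hsig hao hxu hx hxT

/-- **The count (R).** With `C` the complex of `T`, `|A_u ∩ C_u| = |A_u^⊥ ∩ C_u| + 1` — the
hypothesis `hcount` of the unique-non-face lemma and of the anatomy. -/
theorem card_inter_eq_card_complWithin_inter_add_one {C : Finset (Finset α)}
    (hdown : ∀ w ∈ L', ∀ w', w' ⊆ w → w' ∈ L')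
    (hne : T.Nonempty) (hTS : ∀ y ∈ T, y ⊆ S) (hTU : ∀ y ∈ T, S \ y ∈ L')
    (hcnt : ((L'.filter fun w => ∃ y ∈ T, w ⊆ y)).card ≤ T.card + 1)
    (huS : u ⊆ S) (hu : u ∉ L')
    (hsig : ∀ v ∈ L', v ⊆ u → u \ v ∈ L' ∨ ∃ y ∈ T, v ⊆ y)
    (hao : ∃ v₀ ∈ L', v₀ ⊆ u ∧ u \ v₀ ∈ L' ∧ ∀ y ∈ T, ¬ v₀ ⊆ y)
    (hC : ∀ x ∈ C, ∃ t ∈ T, x ⊆ t) (hCT : ∀ t ∈ T, ∀ x, x ⊆ t → x ∈ C) :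
    ((L'.filter fun w => w ⊆ u) ∩ (C.filter fun w => w ⊆ u)).card =
      (complWithin u (L'.filter fun w => w ⊆ u) ∩ (C.filter fun w => w ⊆ u)).card + 1 := by
  -- the left-hand side is the set of faces inside `u`
  have hL : (L'.filter fun w => w ⊆ u) ∩ (C.filter fun w => w ⊆ u) =
      (L'.filter fun w => ∃ y ∈ T, w ⊆ y).filter fun w => w ⊆ u := by
    ext w
    simp only [mem_inter, mem_filter]
    constructor
    · rintro ⟨⟨hw, hwu⟩, hwC, -⟩
      exact ⟨⟨hw, hC w hwC⟩, hwu⟩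
    · rintro ⟨⟨hw, t, ht, hwt⟩, hwu⟩
      exact ⟨⟨hw, hwu⟩, hCT t ht w hwt, hwu⟩
  -- the right-hand side is the set of traces
  have hR : complWithin u (L'.filter fun w => w ⊆ u) ∩ (C.filter fun w => w ⊆ u) =
      T.image fun y => y ∩ u := by
    rw [image_inter_eq_filter hdown hTS hTU hcnt huS hu hsig hao]
    ext x
    simp only [mem_inter, mem_filter, mem_powerset]
    constructor
    · rintro ⟨hx, hxC, hxu⟩
      rw [mem_complWithin_iff_sdiff_mem (fun y hy => (mem_filter.1 hy).2) hxu, mem_filter] at hx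
      exact ⟨hxu, hx.1, hC x hxC⟩
    · rintro ⟨hxu, hx, t, ht, hxt⟩
      refine ⟨?_, hCT t ht x hxt, hxu⟩
      rw [mem_complWithin_iff_sdiff_mem (fun y hy => (mem_filter.1 hy).2) hxu, mem_filter]
      exact ⟨hx, sdiff_subset⟩
  rw [hL, hR]
  exact card_faces_restrict_eq_succ hdown hne hTS hTU hcnt huS hu hsig hao

end Instance

end PercRepro.MSTight
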